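import Summits.Ventures.GridStability.Lyapunov.StructurePreservingBlockCover
import Summits.Ventures.GridStability.Lyapunov.StructurePreservingPolytopeLevel
import HarnessLib

/-!
# Signed couplings VI — the RATIONAL row interface of a block cover: the 3-4-5 box `ρ = 4·arctan(1/3)`,
# half-angle data, and O(1) rational checks per triangle ⇒ the transcendental cover fields and the level

Venture GRIDFUSION, G2-SCALE cell; card «idea-3 (cycle 4) / signed-coupling-triangle-absorption»
(HOME/IDEAS-G2.md § l.675; crit-1 GRADE PASS · NEW-COMBINATION, STATUS 2026-08-28T20:54:27Z); the planner's scratch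
proof `HOME/idea-3/c4/BlockRoaW.lean` (sha16 ce7574047d5005c1, 2 175 lines, farm rc 0 / 0 sorry / standard axioms,
crit-1 g2 independent check STATUS l.10676) filed in content by the cell's Lean-lane seat gridfusion-sos-5 (g11), split
into tree modules `StructurePreservingBlock{Energy,Rows,Cover,Region,Roa,Level,Toys}`; namespace renamed from
`…Ideas.TriangleAbsorption.Roa` to `…Lyapunov.StructurePreserving.SignedBlock`. 0 kit, 0 facts.
THREE COLUMNS: theorems about the MODELLED lossless structure-preserving model MV-3 with SIGNED couplings (negative
branch reactances: three-winding-transformer star equivalents, series capacitors); nothing here is a certificate for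
any benchmark and nothing here certifies a real grid.

WHAT THIS MODULE SAYS (`BlockRoaW.lean` §H + §J's free-edge checks; the per-triangle analogue of the tree's
`StructurePreservingPolytopeLevel` — `hq`, `ratGap`, `ratGap_le_vtGap` are IMPORTED from it, the scratch file's primed
inlined copies are dropped).  Per frustrated triangle the kernel datum is `(m₁, m₂, q₁, q₂) ∈ ℚ⁴`; with the box
half-width fixed at `ρ = 4·arctan(1/3)` (`cos ρ = 7/25`, `sin ρ = 24/25`, `8/5 ≤ ρ² < 16/9`) and the operating point
in half-angle-tangent data (`δ₀ᵢ = 2·arctan tᵢ`, line quotient `q = hq t_leg t_apex`, `cos = (1−q²)/(1+q²)`,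
`sin = 2q/(1+q²)`), the fields `window`, `row_m`, `row_q` of a `BlockCover` and the level comparison `c < F_k`
follow from TEN rational inequalities per triangle; a free edge's level and equilibrium window from one each.

* `RatRows.rho` (+ `cos_rho`, `sin_rho`, `rho_lt`, `sq_rho_ge`, …), `U_rho`, `U_neg_rho`, `U_pm_rho_ge`, `slope_pm_rho_ge`;
* `row_m_of_check`, `row_q_of_check`, `abs_arctan_le_abs`, `window_of_check`, `level_of_check`,
  **`fields_of_checks`** (the three trig fields of one triangle from rational hypotheses);
* `freeLevel_of_check`, `freeWindow_of_check` (free edges, via the tree's `ratGap_le_vtGap`).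
-/

noncomputable section

open Set Filter Topology Real Finset
open Summit.Ventures.GridStability.Models.StructurePreserving
open Summit.Ventures.GridStability.Models.StructurePreserving.Params
open Summit.Ventures.GridStability.Lyapunov.StructurePreserving
open Literature.MathematicalPhysics.PowerSystems.ClassicalModel.LosslessSystem (vtGap)

namespace Summit.Ventures.GridStability.Lyapunov.StructurePreserving.SignedBlock

variable {n : ℕ}

namespace RatRows

/-- The interface box half-width `ρ = 4·arctan(1/3)`. -/
def rho : ℝ := 4 * Real.arctan (1 / 3)

/-- `0 < arctan(1/3)`. [folklore] -/
theorem arctan_third_pos : 0 < Real.arctan (1 / 3 : ℝ) := Real.arctan_pos.mpr (by norm_num)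

/-- `cos(2·arctan(1/3)) = 4/5` (the 3-4-5 triangle). [folklore] -/
theorem cos_two_arctan_third : Real.cos (2 * Real.arctan (1 / 3 : ℝ)) = 4 / 5 := by
  rw [cos_two_mul_arctan]; norm_num

/-- `sin(2·arctan(1/3)) = 3/5` (the 3-4-5 triangle). [folklore] -/
theorem sin_two_arctan_third : Real.sin (2 * Real.arctan (1 / 3 : ℝ)) = 3 / 5 := by
  rw [sin_two_mul_arctan]; norm_num

/-- `ρ = 2·(2·arctan(1/3))`. [folklore] -/
theorem rho_eq : rho = 2 * (2 * Real.arctan (1 / 3 : ℝ)) := by unfold rho; ring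

/-- `cos ρ = 7/25`. -/
theorem cos_rho : Real.cos rho = 7 / 25 := by
  rw [rho_eq, Real.cos_two_mul, cos_two_arctan_third]; norm_num

/-- `sin ρ = 24/25`. -/
theorem sin_rho : Real.sin rho = 24 / 25 := by
  rw [rho_eq, Real.sin_two_mul, sin_two_arctan_third, cos_two_arctan_third]; norm_num

/-- `0 < ρ`. [folklore] -/
theorem rho_pos : 0 < rho := by
  unfold rho; linarith [arctan_third_pos]

/-- `ρ < 4/3` (`arctan(1/3) < tan(arctan(1/3)) = 1/3`). -/
theorem rho_lt : rho < 4 / 3 := by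
  have h1 := Real.lt_tan arctan_third_pos (Real.arctan_lt_pi_div_two _)
  rw [Real.tan_arctan] at h1
  unfold rho; linarith

/-- `8/5 ≤ ρ²` (`sin(arctan(1/3)) = 1/√10 ≤ arctan(1/3)`). -/
theorem sq_rho_ge : 8 / 5 ≤ rho ^ 2 := by
  have h1 : Real.sin (Real.arctan (1 / 3 : ℝ)) ≤ Real.arctan (1 / 3) := Real.sin_le arctan_third_pos.le
  rw [Real.sin_arctan] at h1
  have h2 : (0 : ℝ) ≤ 1 / 3 / Real.sqrt (1 + (1 / 3) ^ 2) := by positivity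
  have h3 : ((1 / 3 : ℝ) / Real.sqrt (1 + (1 / 3) ^ 2)) ^ 2 = 1 / 10 := by
    rw [div_pow, Real.sq_sqrt (by positivity)]; norm_num
  have h4 : (1 / 10 : ℝ) ≤ Real.arctan (1 / 3) ^ 2 := by
    rw [← h3]; exact pow_le_pow_left₀ h2 h1 2
  have h5 : rho ^ 2 = 16 * Real.arctan (1 / 3) ^ 2 := by unfold rho; ring
  rw [h5]; linarith

/-- `ρ² < 16/9`. [folklore] -/
theorem sq_rho_lt : rho ^ 2 < 16 / 9 := by
  have h1 := rho_lt
  have h2 := rho_pos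
  nlinarith

/-- `24/25 ≤ ρ` (from `8/5 ≤ ρ²`). [folklore] -/
theorem rho_sub_nonneg : 0 ≤ rho - 24 / 25 := by
  have h1 := sq_rho_ge
  have h2 := rho_pos
  nlinarith

/-- `ρ − 24/25 ≤ 28/75` (from `ρ < 4/3`). [folklore] -/
theorem rho_sub_le : rho - 24 / 25 ≤ 28 / 75 := by linarith [rho_lt]

/-- Endpoint chord values at the 3-4-5 box. -/
theorem U_rho (a : ℝ) : U a rho = 18 / 25 * Real.cos a + (24 / 25 - rho) * Real.sin a := by
  unfold U; rw [Real.cos_add, cos_rho, sin_rho]; ring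

/-- Endpoint chord value at `−ρ`: `U(a; −ρ) = (18/25)cos a + (ρ − 24/25)sin a`. [folklore] -/
theorem U_neg_rho (a : ℝ) : U a (-rho) = 18 / 25 * Real.cos a + (rho - 24 / 25) * Real.sin a := by
  unfold U; rw [show a + -rho = a - rho by ring, Real.cos_sub, cos_rho, sin_rho]; ring

/-- Endpoint slope at `+ρ`: `sin(a + ρ) − sin a = (24/25)cos a − (18/25)sin a`. [folklore] -/
theorem sin_add_rho_sub (a : ℝ) :
    Real.sin (a + rho) - Real.sin a = 24 / 25 * Real.cos a - 18 / 25 * Real.sin a := by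
  rw [Real.sin_add, cos_rho, sin_rho]; ring

/-- Endpoint slope at `−ρ`: `sin a − sin(a − ρ) = (24/25)cos a + (18/25)sin a`. [folklore] -/
theorem sin_sub_sin_sub_rho (a : ℝ) :
    Real.sin a - Real.sin (a - rho) = 24 / 25 * Real.cos a + 18 / 25 * Real.sin a := by
  rw [Real.sin_sub, cos_rho, sin_rho]; ring

/-- Both endpoint chord values dominate the rational expression `(18/25)·cos a − (28/75)·|sin a|`. -/
theorem U_pm_rho_ge (a : ℝ) :
    18 / 25 * Real.cos a - 28 / 75 * |Real.sin a| ≤ U a rho ∧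
      18 / 25 * Real.cos a - 28 / 75 * |Real.sin a| ≤ U a (-rho) := by
  rw [U_rho, U_neg_rho]
  have h0 := rho_sub_nonneg
  have h1 := rho_sub_le
  have hS := abs_nonneg (Real.sin a)
  rcases abs_cases (Real.sin a) with ⟨h, _⟩ | ⟨h, _⟩ <;> rw [h] at hS ⊢ <;> constructor <;> nlinarith

/-- Both endpoint slopes dominate `(24/25)·cos a − (18/25)·|sin a|`. -/
theorem slope_pm_rho_ge (a : ℝ) :
    24 / 25 * Real.cos a - 18 / 25 * |Real.sin a| ≤ Real.sin (a + rho) - Real.sin a ∧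
      24 / 25 * Real.cos a - 18 / 25 * |Real.sin a| ≤ Real.sin a - Real.sin (a - rho) := by
  rw [sin_add_rho_sub, sin_sub_sin_sub_rho]
  rcases abs_cases (Real.sin a) with ⟨h, _⟩ | ⟨h, _⟩ <;> rw [h] <;> constructor <;> linarith

/-- **Curvature rows from one rational check**: `m·(16/9) ≤ β·((18/25)cos a − (28/75)|sin a|)`, `m, β ≥ 0`
⇒ `m·ρ² ≤ β·U(a; ±ρ)`. -/
theorem row_m_of_check {β m a : ℝ} (hβ : 0 ≤ β) (hm : 0 ≤ m)
    (h : m * (16 / 9) ≤ β * (18 / 25 * Real.cos a - 28 / 75 * |Real.sin a|)) :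
    m * rho ^ 2 ≤ β * U a rho ∧ m * rho ^ 2 ≤ β * U a (-rho) := by
  have h1 : m * rho ^ 2 ≤ m * (16 / 9) := mul_le_mul_of_nonneg_left sq_rho_lt.le hm
  obtain ⟨h2, h3⟩ := U_pm_rho_ge a
  exact ⟨h1.trans (h.trans (mul_le_mul_of_nonneg_left h2 hβ)),
    h1.trans (h.trans (mul_le_mul_of_nonneg_left h3 hβ))⟩

/-- **Slope rows from one rational check**: `q·(4/3) ≤ β·((24/25)cos a − (18/25)|sin a|)`, `q, β ≥ 0`
⇒ `q·ρ ≤ β·(sin(a+ρ) − sin a)` and `q·ρ ≤ β·(sin a − sin(a−ρ))`. -/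
theorem row_q_of_check {β q a : ℝ} (hβ : 0 ≤ β) (hq0 : 0 ≤ q)
    (h : q * (4 / 3) ≤ β * (24 / 25 * Real.cos a - 18 / 25 * |Real.sin a|)) :
    q * rho ≤ β * (Real.sin (a + rho) - Real.sin a) ∧ q * rho ≤ β * (Real.sin a - Real.sin (a - rho)) := by
  have h1 : q * rho ≤ q * (4 / 3) := mul_le_mul_of_nonneg_left rho_lt.le hq0
  obtain ⟨h2, h3⟩ := slope_pm_rho_ge a
  exact ⟨h1.trans (h.trans (mul_le_mul_of_nonneg_left h2 hβ)),
    h1.trans (h.trans (mul_le_mul_of_nonneg_left h3 hβ))⟩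

/-- `|arctan x| ≤ |x|`. -/
theorem abs_arctan_le_abs (x : ℝ) : |Real.arctan x| ≤ |x| := by
  have key : ∀ y : ℝ, 0 ≤ y → Real.arctan y ≤ y := fun y hy => by
    rcases hy.lt_or_eq with hy | hy
    · have h := Real.lt_tan (Real.arctan_pos.mpr hy) (Real.arctan_lt_pi_div_two y)
      rw [Real.tan_arctan] at h
      exact h.le
    · rw [← hy, Real.arctan_zero]
  have key0 : ∀ y : ℝ, 0 ≤ y → 0 ≤ Real.arctan y := fun y hy => by
    have := Real.arctan_strictMono.monotone hy
    rwa [Real.arctan_zero] at this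
  rcases le_total 0 x with hx | hx
  · rw [abs_of_nonneg (key0 x hx), abs_of_nonneg hx]
    exact key x hx
  · have hx' : 0 ≤ -x := neg_nonneg.mpr hx
    rw [abs_of_nonpos hx, abs_of_nonpos (by
      have := key0 (-x) hx'; rw [Real.arctan_neg] at this; linarith)]
    have := key (-x) hx'
    rw [Real.arctan_neg] at this
    linarith

/-- **Window from one rational check** (half-angle data): `2|q| + 4/3 ≤ 1.570796` with `q = hq u v`,
`uv > −1` ⇒ `|2·arctan u − 2·arctan v| + ρ ≤ π/2`. -/
theorem window_of_check {u v : ℝ} (huv : -1 < u * v)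
    (h : 2 * |hq u v| + 4 / 3 ≤ 1570796 / 1000000) :
    |2 * Real.arctan u - 2 * Real.arctan v| + rho ≤ π / 2 := by
  rw [two_mul_arctan_sub huv]
  have h1 : |2 * Real.arctan ((u - v) / (1 + u * v))| ≤ 2 * |hq u v| := by
    rw [abs_mul, abs_of_pos (by norm_num : (0 : ℝ) < 2)]
    exact mul_le_mul_of_nonneg_left (abs_arctan_le_abs _) (by norm_num)
  have h2 := rho_lt
  have h3 := Real.pi_gt_d6
  linarith

/-- **Level below a block face from two rational checks**: `c < (8/5)·Bᵢ` with `Bᵢ ≥ 0` the two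
series–parallel brackets ⇒ `c < F_K` for a triangle at the interface box. -/
theorem level_of_check (K : Triangle n) (hK : K.ρ = rho) {γ c : ℝ}
    (hB₁ : 0 ≤ K.m₁ - γ * K.m₂ / (2 * K.m₂ - γ)) (hB₂ : 0 ≤ K.m₂ - γ * K.m₁ / (2 * K.m₁ - γ))
    (h₁ : c < 8 / 5 * (K.m₁ - γ * K.m₂ / (2 * K.m₂ - γ)))
    (h₂ : c < 8 / 5 * (K.m₂ - γ * K.m₁ / (2 * K.m₁ - γ))) : c < K.face γ := by
  unfold Triangle.face
  rw [hK]
  have hρ := sq_rho_ge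
  exact lt_min (h₁.trans_le (mul_le_mul_of_nonneg_right hρ hB₁))
    (h₂.trans_le (mul_le_mul_of_nonneg_right hρ hB₂))

/-- **The three transcendental fields of a cover triangle from six rational checks** (half-angle
equilibrium `δ₀ = halfAngle t`, triangle at the interface box): window, curvature rows and slope rows of
`K` in EXACTLY the shape of `BlockCover.window / row_m / row_q`, from rational inequalities in the
half-angle quotients `qᵢ = hq (t legᵢ) (t apex)` and the triangle's own leg masses `w₁, w₂`. -/
theorem fields_of_checks (K : Triangle n) (hK : K.ρ = rho) (t : Fin n → ℝ)
    (h1 : -1 < t K.leg₁ * t K.apex) (h2 : -1 < t K.leg₂ * t K.apex)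
    (hβ₁ : 0 ≤ K.w₁) (hβ₂ : 0 ≤ K.w₂) (hm₁ : 0 ≤ K.m₁) (hm₂ : 0 ≤ K.m₂)
    (hq₁ : 0 ≤ K.q₁) (hq₂ : 0 ≤ K.q₂)
    (w₁ : 2 * |hq (t K.leg₁) (t K.apex)| + 4 / 3 ≤ 1570796 / 1000000)
    (w₂ : 2 * |hq (t K.leg₂) (t K.apex)| + 4 / 3 ≤ 1570796 / 1000000)
    (cm₁ : K.m₁ * (16 / 9) ≤ K.w₁ *
      (18 / 25 * ((1 - hq (t K.leg₁) (t K.apex) ^ 2) / (1 + hq (t K.leg₁) (t K.apex) ^ 2))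
        - 28 / 75 * |2 * hq (t K.leg₁) (t K.apex) / (1 + hq (t K.leg₁) (t K.apex) ^ 2)|))
    (cm₂ : K.m₂ * (16 / 9) ≤ K.w₂ *
      (18 / 25 * ((1 - hq (t K.leg₂) (t K.apex) ^ 2) / (1 + hq (t K.leg₂) (t K.apex) ^ 2))
        - 28 / 75 * |2 * hq (t K.leg₂) (t K.apex) / (1 + hq (t K.leg₂) (t K.apex) ^ 2)|))
    (cq₁ : K.q₁ * (4 / 3) ≤ K.w₁ *
      (24 / 25 * ((1 - hq (t K.leg₁) (t K.apex) ^ 2) / (1 + hq (t K.leg₁) (t K.apex) ^ 2))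
        - 18 / 25 * |2 * hq (t K.leg₁) (t K.apex) / (1 + hq (t K.leg₁) (t K.apex) ^ 2)|))
    (cq₂ : K.q₂ * (4 / 3) ≤ K.w₂ *
      (24 / 25 * ((1 - hq (t K.leg₂) (t K.apex) ^ 2) / (1 + hq (t K.leg₂) (t K.apex) ^ 2))
        - 18 / 25 * |2 * hq (t K.leg₂) (t K.apex) / (1 + hq (t K.leg₂) (t K.apex) ^ 2)|)) :
    (|(2 * Real.arctan (t K.leg₁)) - (2 * Real.arctan (t K.apex))| + K.ρ ≤ π / 2 ∧
      |(2 * Real.arctan (t K.leg₂)) - (2 * Real.arctan (t K.apex))| + K.ρ ≤ π / 2) ∧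
    ((K.m₁ * K.ρ ^ 2 ≤ K.w₁ * U ((2 * Real.arctan (t K.leg₁)) - (2 * Real.arctan (t K.apex))) K.ρ ∧
      K.m₁ * K.ρ ^ 2 ≤ K.w₁ * U ((2 * Real.arctan (t K.leg₁)) - (2 * Real.arctan (t K.apex))) (-K.ρ)) ∧
     (K.m₂ * K.ρ ^ 2 ≤ K.w₂ * U ((2 * Real.arctan (t K.leg₂)) - (2 * Real.arctan (t K.apex))) K.ρ ∧
      K.m₂ * K.ρ ^ 2 ≤ K.w₂ * U ((2 * Real.arctan (t K.leg₂)) - (2 * Real.arctan (t K.apex))) (-K.ρ))) ∧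
    ((K.q₁ * K.ρ ≤ K.w₁ *
        (Real.sin ((2 * Real.arctan (t K.leg₁)) - (2 * Real.arctan (t K.apex)) + K.ρ) - Real.sin ((2 * Real.arctan (t K.leg₁)) - (2 * Real.arctan (t K.apex)))) ∧
      K.q₁ * K.ρ ≤ K.w₁ *
        (Real.sin ((2 * Real.arctan (t K.leg₁)) - (2 * Real.arctan (t K.apex))) - Real.sin ((2 * Real.arctan (t K.leg₁)) - (2 * Real.arctan (t K.apex)) - K.ρ))) ∧
     (K.q₂ * K.ρ ≤ K.w₂ *
        (Real.sin ((2 * Real.arctan (t K.leg₂)) - (2 * Real.arctan (t K.apex)) + K.ρ) - Real.sin ((2 * Real.arctan (t K.leg₂)) - (2 * Real.arctan (t K.apex)))) ∧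
      K.q₂ * K.ρ ≤ K.w₂ *
        (Real.sin ((2 * Real.arctan (t K.leg₂)) - (2 * Real.arctan (t K.apex))) - Real.sin ((2 * Real.arctan (t K.leg₂)) - (2 * Real.arctan (t K.apex)) - K.ρ)))) := by
  have e₁ : (2 * Real.arctan (t K.leg₁)) - (2 * Real.arctan (t K.apex))
      = 2 * Real.arctan (t K.leg₁) - 2 * Real.arctan (t K.apex) := rfl
  have e₂ : (2 * Real.arctan (t K.leg₂)) - (2 * Real.arctan (t K.apex))
      = 2 * Real.arctan (t K.leg₂) - 2 * Real.arctan (t K.apex) := rfl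
  rw [← cos_halfAngle_sub h1, ← sin_halfAngle_sub' h1] at cm₁ cq₁
  rw [← cos_halfAngle_sub h2, ← sin_halfAngle_sub' h2] at cm₂ cq₂
  rw [hK]
  exact ⟨⟨window_of_check h1 w₁, window_of_check h2 w₂⟩,
    ⟨row_m_of_check hβ₁ hm₁ cm₁, row_m_of_check hβ₂ hm₂ cm₂⟩,
    ⟨row_q_of_check hβ₁ hq₁ cq₁, row_q_of_check hβ₂ hq₂ cq₂⟩⟩


/-! ### Free edges next to a block cover: level and equilibrium window from one rational check each -/

/-- **Free-edge level from one rational check**: `c < w·ratGap (hq u v)`, `w ≥ 0`, `uv > −1`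
⇒ `c < w·vtGap(2·arctan u − 2·arctan v)` and the same for the reversed orientation (tree `ratGap_le_vtGap`,
`vtGap_neg`). [folklore] -/
theorem freeLevel_of_check {w c u v : ℝ} (hw : 0 ≤ w) (huv : -1 < u * v)
    (h : c < w * ratGap (hq u v)) :
    c < w * vtGap (2 * Real.arctan u - 2 * Real.arctan v) ∧
      c < w * vtGap (2 * Real.arctan v - 2 * Real.arctan u) := by
  have h1 := h.trans_le (mul_le_mul_of_nonneg_left (ratGap_le_vtGap huv) hw)
  refine ⟨h1, ?_⟩
  rwa [show 2 * Real.arctan v - 2 * Real.arctan u = -(2 * Real.arctan u - 2 * Real.arctan v) by ring,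
    vtGap_neg]

/-- **Free-edge equilibrium window from one rational check**: `2|hq u v| < 1.570796`, `uv > −1`
⇒ `|2·arctan u − 2·arctan v| < π/2`. [folklore] -/
theorem freeWindow_of_check {u v : ℝ} (huv : -1 < u * v) (h : 2 * |hq u v| < 1570796 / 1000000) :
    |2 * Real.arctan u - 2 * Real.arctan v| < π / 2 := by
  rw [two_mul_arctan_sub huv]
  have h1 : |2 * Real.arctan ((u - v) / (1 + u * v))| ≤ 2 * |hq u v| := by
    rw [abs_mul, abs_of_pos (by norm_num : (0 : ℝ) < 2)]
    exact mul_le_mul_of_nonneg_left (abs_arctan_le_abs _) (by norm_num)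
  have h3 := Real.pi_gt_d6
  linarith

end RatRows


end Summit.Ventures.GridStability.Lyapunov.StructurePreserving.SignedBlock

end
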